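import Mathlib
import Literature.Probability.LatticeModels.LatticeGraph
import Summits.CriticalPhenomena.Ising3DConformalLimit.Theorems.GaussianScaleMixtureCriticalTwoPointGSMCubeRepOfApproximants
import Summits.CriticalPhenomena.Ising3DConformalLimit.Theorems.GaussianScaleMixtureCriticalTwoPointGSMCubeRepApproxOfDualCone
import Summits.CriticalPhenomena.Ising3DConformalLimit.Theorems.GaussianScaleMixtureCriticalTwoPointGSMCubeRepOfCubeRepApprox
import Summits.CriticalPhenomena.Ising3DConformalLimit.Theorems.GaussianScaleMixtureCriticalTwoPointGSMExchangeableCubeRepOfCubeRep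

/-!
# Closed Gaussian-scale-mixture cone = dual cone on `ℤ³`

Pure measure theory / convex analysis, used by line `Sketch` of the crux `CriticalTwoPointGSM`
(stmt-CriticalPhenomena-8365). A CUBE REPRESENTATION of a kernel `G : ℤ³ → ℝ` is a probability
measure `μ` on `ℝ³` carried by the closed cube `[0,1]³` (no mass on the open complement
`{t | ∃ i, tᵢ < 0 ∨ 1 < tᵢ}`) with `G x = ∫ ∏ᵢ tᵢ^{xᵢ²} dμ(t)` for every site `x`
(natural-number powers, `0⁰ = 1`), i.e. membership of `G` in the closed Gaussian-scale-mixture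
cone. The DUAL-CONE inequalities for `G` say: whenever a finite combination
`∑ₖ cₖ ∏ᵢ tᵢ^{x_{k,i}²}` of the polynomial kernels is non-negative on the cube, the same
combination `∑ₖ cₖ G(xₖ)` of the values of `G` is non-negative.

Main result `cubeRep_iff_dualCone`: `G` has a cube representation iff `G 0 = 1` and `G` passes
every dual-cone inequality (the certificate form of closed-cone membership).

* `→`: `G 0 = ∫ ∏ᵢ tᵢ⁰ dμ = μ(ℝ³) = 1`; and for a combination non-negative on the cube,
  `∑ₖ cₖ G(xₖ) = ∫ ∑ₖ cₖ ∏ᵢ tᵢ^{x_{k,i}²} dμ ≥ 0`, since `μ`-a.e. point lies in the cube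
  (`CriticalTwoPointGSMCube.ae_mem_cube`) and each kernel is integrable there
  (`CriticalTwoPointGSMCubeSymm.integrable_polyKernel`, `integral_finsetSum`,
  `integral_nonneg_of_ae`).
* `←`: the two landed halves, finite-family separation `cubeRepApprox_of_dualCone`
  (Minkowski/Hahn–Banach in `ℝ^m`) and the compactness step `cubeRep_of_cubeRepApprox`
  (Prokhorov on the compact cube).
-/

namespace Summit.CriticalPhenomena.Ising3DConformalLimit.Theorems

open MeasureTheory Filter Topology
open Literature.Probability.LatticeModels
open scoped BigOperators

namespace CriticalTwoPointGSMDualConeIff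

open CriticalTwoPointGSMCube (ae_mem_cube)
open CriticalTwoPointGSMCubeSymm (integrable_polyKernel)

/-- The kernel of the site `0` is the constant `1`, so it integrates to `1` against a
probability measure. -/
theorem integral_kernel_zero (μ : Measure (Fin 3 → ℝ)) [IsProbabilityMeasure μ] :
    ∫ t, ∏ i, (t i) ^ (((0 : Site 3) i).natAbs ^ 2) ∂μ = 1 := by
  simp

/-- `→`, main part: a kernel with a cube representation passes every dual-cone inequality —
integrate the pointwise inequality on the cube against the representing measure. -/
theorem dualCone_of_cubeRep {G : Site 3 → ℝ} {μ : Measure (Fin 3 → ℝ)} [IsProbabilityMeasure μ]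
    (hcube : μ {t | ∃ i, t i < 0 ∨ 1 < t i} = 0)
    (hrep : ∀ x : Site 3, G x = ∫ t, ∏ i, (t i) ^ ((x i).natAbs ^ 2) ∂μ)
    {m : ℕ} (c : Fin m → ℝ) (x : Fin m → Site 3)
    (hc : ∀ t : Fin 3 → ℝ, (∀ i, 0 ≤ t i ∧ t i ≤ 1) →
      0 ≤ ∑ k, c k * ∏ i, (t i) ^ ((x k i).natAbs ^ 2)) :
    0 ≤ ∑ k, c k * G (x k) := by
  have key : ∑ k, c k * G (x k) = ∫ t, ∑ k, c k * ∏ i, (t i) ^ ((x k i).natAbs ^ 2) ∂μ := by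
    rw [integral_finsetSum _ fun k _ => (integrable_polyKernel hcube (x k)).const_mul (c k)]
    refine Finset.sum_congr rfl fun k _ => ?_
    rw [integral_const_mul, hrep]
  rw [key]
  refine integral_nonneg_of_ae ?_
  filter_upwards [ae_mem_cube hcube] with t ht
  exact hc t ht

end CriticalTwoPointGSMDualConeIff

open CriticalTwoPointGSMDualConeIff in
/-- **Closed Gaussian-scale-mixture cone = dual cone.** A kernel `G` on `ℤ³` has a cube
representation — a probability measure `μ` on `ℝ³` carried by the closed cube `[0,1]³` with
`G x = ∫ ∏ᵢ tᵢ^{xᵢ²} dμ` — iff `G 0 = 1` and `G` passes EVERY dual-cone inequality: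
`∑ₖ cₖ G(xₖ) ≥ 0` whenever `∑ₖ cₖ ∏ᵢ tᵢ^{x_{k,i}²} ≥ 0` on `[0,1]³`. (`→`: integrate the pointwise
inequality against `μ`; `←`: finite-family separation `cubeRepApprox_of_dualCone` followed by the
compactness step `cubeRep_of_cubeRepApprox`.) -/
theorem cubeRep_iff_dualCone (G : Site 3 → ℝ) :
    (∃ μ : Measure (Fin 3 → ℝ), IsProbabilityMeasure μ ∧ μ {t | ∃ i, t i < 0 ∨ 1 < t i} = 0 ∧
      ∀ x : Site 3, G x = ∫ t, ∏ i, (t i) ^ ((x i).natAbs ^ 2) ∂μ) ↔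
    (G 0 = 1 ∧ ∀ (m : ℕ) (c : Fin m → ℝ) (x : Fin m → Site 3),
      (∀ t : Fin 3 → ℝ, (∀ i, 0 ≤ t i ∧ t i ≤ 1) →
        0 ≤ ∑ k, c k * ∏ i, (t i) ^ ((x k i).natAbs ^ 2)) →
      0 ≤ ∑ k, c k * G (x k)) := by
  constructor
  · rintro ⟨μ, hP, hcube, hrep⟩
    refine ⟨?_, fun m c x hc => dualCone_of_cubeRep hcube hrep c x hc⟩
    rw [hrep 0]
    exact integral_kernel_zero μ
  · rintro ⟨hG0, hdual⟩
    exact cubeRep_of_cubeRepApprox G fun m x ε hε => cubeRepApprox_of_dualCone G hG0 hdual m x hε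

end Summit.CriticalPhenomena.Ising3DConformalLimit.Theorems
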